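import Mathlib.Analysis.SpecialFunctions.Pow.Real
import Mathlib.Analysis.SpecialFunctions.Sqrt
import Mathlib.Analysis.InnerProductSpace.Calculus
import Mathlib.Analysis.SpecialFunctions.ExpDeriv
import HarnessLib

/-!
# The transit past an index-one critical point in Milnor's model flow: a polar blow-down

Topic `Literature/Topology/FourManifolds`; explicit calculus in the local model of a
gradient-like field near a critical point of index one (Milnor, *Lectures on the h-cobordism
theorem* (1965), Def. 3.1: in a Morse chart `f = c - x² + ‖w‖²` and `ξ = (-x, w)`, the tree's
`milnorQuadratic 1` / `milnorModelField 1` of `GradientLike.lean`), written on `ℝ × F` for a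
real inner product space `F` (the case `F = ℝ²` is the `3`-dimensional `1`-handle).
**Everything is proved; the definitions are explicit formulas; no named facts.**

The model flow is `φ_t (x, w) = (e^{-t} x, e^{t} w)` (`modelFlow`; `hasDerivAt_modelFlow`); the
product `x w` is invariant (`modelFlow_fst_smul_snd`), the unstable manifold of the origin is
`{x = 0}` (the co-core) and the stable one `{w = 0}` (the core), the levels of
`q = -x² + ‖w‖²` are the hyperboloids `{q = ±ε}`.  Flowing DOWN (backwards) from a point
`(x, w)` with `x > 0`, the trajectory meets the sheet `x' > 0` of the lower level
`{x'² - ‖w'‖² = ε}` in the **transit point**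

  `T (x, w) = (x'(m), (x / x'(m)) w)`,  `m = x ‖w‖`,  `x'(m)² = X(m) = (ε + √(ε² + 4m²))/2`

(`transit`, `transit_eq_modelFlow`, `transit_level`): `X` is the positive root of
`X² - εX = m²` (`exitSq_sq_sub`).  In polar coordinates of the `w`-plane this is the
**blow-down** `T (x, s θ) = (x'(x s), r(x s) θ)` (`transit_smul_unit`) with the radial function
`r(m) = m / x'(m)` (`radial`): smooth, odd, strictly increasing, onto `ℝ`, `r(0) = 0`,
`r² = X - ε` (`contDiff_radial`, `strictMono_radial`, `radial_surjective`, `radial_sq`).  So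
the circle `{x} × {‖w‖ = s}` of the upper region is carried onto the circle of radius `r(xs)`
around the foot `(√ε, 0)` of the core, each point along its own ray, and collapses onto the
foot as `x ↓ 0` (`transit_zero_fst`; `contDiff_transit`: `T` is smooth on all of `ℝ × F`).

This is the local analysis behind the statement that, for a `1`-handlebody with boundary-adapted
Morse data, flowing down from the boundary surface past a saddle `q` identifies
`S ∖ (belt circle of q)` near the belt circle with a punctured neighbourhood of the foot of `q`
in the lower level, by the polar blow-down of a collar of the belt circle (used to transport
curves and regions between the boundary and the level tori in the wave argument for cut systems;
Hensel (2020), §5; the meridian-disc half of Griffiths' theorem,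
`HandlebodyKernelExtensionTorelli.lean`).

## References

* J. Milnor, *Lectures on the h-cobordism theorem* (1965), Def. 3.1, Def. 3.9, proof of
  Thm. 3.13. [MilnorHCobordism1965]
* S. Hensel, *A primer on handlebody groups* (2020), §5. [Hensel2020HandlebodyPrimer]
-/

open Set Function Real
open scoped Topology ContDiff

noncomputable section

namespace Literature.Topology.FourManifolds

namespace SaddleTransit

/-! ### §1 The exit abscissa and the radial function of the invariant `m = x‖w‖` -/

/-- The squared exit abscissa `X(m) = (ε + √(ε² + 4m²))/2`, the positive root of
`X² - εX - m² = 0`. [folklore] -/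
def exitSq (ε m : ℝ) : ℝ := (ε + √(ε ^ 2 + 4 * m ^ 2)) / 2

variable {ε : ℝ}

/-- `ε ≤ √(ε² + 4m²)` for `ε ≥ 0`. [folklore] -/
theorem le_sqrt_sq_add (hε : 0 ≤ ε) (m : ℝ) : ε ≤ √(ε ^ 2 + 4 * m ^ 2) := by
  calc ε = √(ε ^ 2) := (sqrt_sq hε).symm
    _ ≤ √(ε ^ 2 + 4 * m ^ 2) := sqrt_le_sqrt (by nlinarith [sq_nonneg m])

/-- `X(m) ≥ ε`. [folklore] -/
theorem le_exitSq (hε : 0 ≤ ε) (m : ℝ) : ε ≤ exitSq ε m := by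
  unfold exitSq; have := le_sqrt_sq_add hε m; linarith

/-- `X(m) > 0` for `ε > 0`. [folklore] -/
theorem exitSq_pos (hε : 0 < ε) (m : ℝ) : 0 < exitSq ε m := hε.trans_le (le_exitSq hε.le m)

/-- **The quadratic equation** `X² - εX = m²`. [folklore] -/
theorem exitSq_sq_sub (ε m : ℝ) : exitSq ε m ^ 2 - ε * exitSq ε m = m ^ 2 := by
  unfold exitSq
  have hS : (√(ε ^ 2 + 4 * m ^ 2)) ^ 2 = ε ^ 2 + 4 * m ^ 2 := sq_sqrt (by positivity)
  nlinarith [hS]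

/-- `X` is an even function of `m`. [folklore] -/
theorem exitSq_neg (ε m : ℝ) : exitSq ε (-m) = exitSq ε m := by simp [exitSq]

/-- `X(0) = ε` (`ε ≥ 0`). [folklore] -/
theorem exitSq_zero (hε : 0 ≤ ε) : exitSq ε 0 = ε := by
  simp [exitSq, sqrt_sq hε]

/-- `X` is smooth (`ε > 0`). [folklore] -/
theorem contDiff_exitSq (hε : 0 < ε) {n : ℕ∞} : ContDiff ℝ n (exitSq ε) := by
  unfold exitSq
  refine (contDiff_const.add (ContDiff.sqrt ?_ fun m => ?_)).div_const _
  · exact contDiff_const.add (contDiff_const.mul (contDiff_id.pow 2))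
  · positivity

/-- `X` is strictly increasing on `[0, ∞)` (`ε ≥ 0`). [folklore] -/
theorem strictMonoOn_exitSq (ε : ℝ) : StrictMonoOn (exitSq ε) (Ici 0) := by
  intro a ha b hb hab
  unfold exitSq
  have : √(ε ^ 2 + 4 * a ^ 2) < √(ε ^ 2 + 4 * b ^ 2) := by
    apply sqrt_lt_sqrt (by positivity)
    have : a ^ 2 < b ^ 2 := by
      have ha' : (0 : ℝ) ≤ a := ha
      nlinarith
    linarith
  linarith

/-- The exit abscissa `x'(m) = √X(m) > 0` (the sheet `x' > 0` of the lower level). [folklore] -/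
def exitX (ε m : ℝ) : ℝ := √(exitSq ε m)

/-- `x' > 0`. [folklore] -/
theorem exitX_pos (hε : 0 < ε) (m : ℝ) : 0 < exitX ε m := sqrt_pos.2 (exitSq_pos hε m)

/-- `x'² = X`. [folklore] -/
theorem exitX_sq (hε : 0 < ε) (m : ℝ) : exitX ε m ^ 2 = exitSq ε m := sq_sqrt (exitSq_pos hε m).le

/-- `x'` is smooth. [folklore] -/
theorem contDiff_exitX (hε : 0 < ε) {n : ℕ∞} : ContDiff ℝ n (exitX ε) :=
  (contDiff_exitSq hε).sqrt fun m => (exitSq_pos hε m).ne'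

/-- `x'` is even. [folklore] -/
theorem exitX_neg (ε m : ℝ) : exitX ε (-m) = exitX ε m := by rw [exitX, exitX, exitSq_neg]

/-- The radial function `r(m) = m / x'(m)` of the blow-down. [folklore] -/
def radial (ε m : ℝ) : ℝ := m / exitX ε m

/-- `r` is smooth. [folklore] -/
theorem contDiff_radial (hε : 0 < ε) {n : ℕ∞} : ContDiff ℝ n (radial ε) :=
  contDiff_id.div (contDiff_exitX hε) fun m => (exitX_pos hε m).ne'

/-- `r` is odd. [folklore] -/
theorem radial_neg (ε m : ℝ) : radial ε (-m) = -radial ε m := by rw [radial, radial, exitX_neg, neg_div]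

/-- `r(0) = 0`. [folklore] -/
@[simp] theorem radial_zero (ε : ℝ) : radial ε 0 = 0 := by simp [radial]

/-- **The level identity** `x'(m)² - r(m)² = ε`: the point `(x'(m), r(m) θ)` lies on the lower
level `{x² - ‖w‖² = ε}` for every unit vector `θ`. [folklore] -/
theorem exitX_sq_sub_radial_sq (hε : 0 < ε) (m : ℝ) : exitX ε m ^ 2 - radial ε m ^ 2 = ε := by
  have hX := exitX_sq hε m
  have hq := exitSq_sq_sub ε m
  have hx0 := (exitX_pos hε m).ne'
  have hpos := exitSq_pos hε m
  rw [radial, div_pow, hX, eq_comm, ← sub_eq_zero]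
  have : exitSq ε m - m ^ 2 / exitSq ε m - ε =
      (exitSq ε m ^ 2 - ε * exitSq ε m - m ^ 2) / exitSq ε m := by
    field_simp
    ring
  rw [show ε - (exitSq ε m - m ^ 2 / exitSq ε m) = -(exitSq ε m - m ^ 2 / exitSq ε m - ε) by ring,
    this, hq, sub_self, zero_div, neg_zero]

/-- `r(m)² = X(m) - ε`. [folklore] -/
theorem radial_sq (hε : 0 < ε) (m : ℝ) : radial ε m ^ 2 = exitSq ε m - ε := by
  have := exitX_sq_sub_radial_sq hε m; rw [exitX_sq hε] at this; linarith

/-- `r` has the sign of `m`: `0 ≤ r(m)` for `0 ≤ m`. [folklore] -/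
theorem radial_nonneg (hε : 0 < ε) {m : ℝ} (hm : 0 ≤ m) : 0 ≤ radial ε m :=
  div_nonneg hm (exitX_pos hε m).le

/-- On `[0, ∞)`, `r = √(X - ε)`. [folklore] -/
theorem radial_eq_sqrt (hε : 0 < ε) {m : ℝ} (hm : 0 ≤ m) : radial ε m = √(exitSq ε m - ε) := by
  rw [← radial_sq hε, sqrt_sq (radial_nonneg hε hm)]

/-- **`r` is strictly increasing** (odd, and `√(X - ε)` with `X` strictly increasing on
`[0, ∞)`). [folklore] -/
theorem strictMono_radial (hε : 0 < ε) : StrictMono (radial ε) := by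
  have hpos : StrictMonoOn (radial ε) (Ici 0) := by
    intro a ha b hb hab
    rw [radial_eq_sqrt hε ha, radial_eq_sqrt hε hb]
    exact sqrt_lt_sqrt (by linarith [le_exitSq hε.le a]) (by linarith [strictMonoOn_exitSq ε ha hb hab])
  intro a b hab
  rcases le_or_gt 0 a with ha | ha
  · exact hpos ha (ha.trans hab.le) hab
  rcases le_or_gt 0 b with hb | hb
  · -- `a < 0 ≤ b`: `r a < 0 ≤ r b`
    have h1 : radial ε a < 0 := by
      have : 0 < radial ε (-a) := by
        have h := hpos (show (0 : ℝ) ∈ Ici 0 from mem_Ici.2 le_rfl) (show -a ∈ Ici (0 : ℝ) by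
          simp only [mem_Ici]; linarith) (by linarith)
        rwa [radial_zero] at h
      rw [radial_neg] at this; linarith
    exact h1.trans_le (radial_nonneg hε hb)
  · -- both negative: use oddness
    have h := hpos (show -b ∈ Ici (0 : ℝ) by simp only [mem_Ici]; linarith)
      (show -a ∈ Ici (0 : ℝ) by simp only [mem_Ici]; linarith) (by linarith)
    rw [radial_neg, radial_neg] at h
    linarith

/-- `r` is unbounded: `r(m)² = X(m) - ε ≥ ... ` tends to infinity, so `r` is a bijection of `ℝ`
(strictly increasing, continuous, odd, unbounded). [folklore] -/
theorem radial_surjective (hε : 0 < ε) : Surjective (radial ε) := by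
  have hc : Continuous (radial ε) := (contDiff_radial hε (n := 0)).continuous
  -- `r(m)² ≥ |m| - ε`, since `X(m) ≥ |m|`
  have hX : ∀ m, |m| ≤ exitSq ε m := fun m => by
    unfold exitSq
    have h1 : 2 * |m| ≤ √(ε ^ 2 + 4 * m ^ 2) := by
      rw [show 2 * |m| = √((2 * |m|) ^ 2) from (sqrt_sq (by positivity)).symm]
      exact sqrt_le_sqrt (by nlinarith [sq_abs m, hε.le])
    linarith [abs_nonneg m, hε.le]
  have htop : Filter.Tendsto (radial ε) Filter.atTop Filter.atTop := by
    refine Filter.tendsto_atTop_atTop.2 fun C => ⟨max 0 ((max C 0) ^ 2 + ε), fun m hm => ?_⟩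
    have hm0 : 0 ≤ m := (le_max_left _ _).trans hm
    have h2 : (max C 0) ^ 2 ≤ radial ε m ^ 2 := by
      rw [radial_sq hε]
      have := hX m; rw [abs_of_nonneg hm0] at this
      linarith [le_max_right 0 ((max C 0) ^ 2 + ε)]
    have h3 : max C 0 ≤ radial ε m :=
      (pow_le_pow_iff_left₀ (le_max_right C 0) (radial_nonneg hε hm0) two_ne_zero).1 h2
    exact (le_max_left C 0).trans h3
  have hbot : Filter.Tendsto (radial ε) Filter.atBot Filter.atBot := by
    have h1 : Filter.Tendsto (fun m => -radial ε (-m)) Filter.atBot Filter.atBot :=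
      Filter.tendsto_neg_atTop_atBot.comp (htop.comp Filter.tendsto_neg_atBot_atTop)
    refine h1.congr fun m => ?_
    rw [radial_neg, neg_neg]
  exact hc.surjective htop hbot

/-! ### §2 The model flow and the transit map -/

variable {F : Type*} [NormedAddCommGroup F] [InnerProductSpace ℝ F]

/-- **Milnor's model flow** past an index-one critical point: the flow of the field
`(x, w) ↦ (-x, w)` (`milnorModelField 1` on `ℝ × F`) is `φ_t (x, w) = (e^{-t} x, e^{t} w)`.
[folklore] -/
def modelFlow (t : ℝ) (p : ℝ × F) : ℝ × F := (exp (-t) * p.1, exp t • p.2)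

/-- The model flow is a flow: `φ_0 = id`. [folklore] -/
@[simp] theorem modelFlow_zero (p : ℝ × F) : modelFlow 0 p = p := by
  simp [modelFlow]

/-- The model flow is a flow: `φ_{s+t} = φ_s ∘ φ_t`. [folklore] -/
theorem modelFlow_add (s t : ℝ) (p : ℝ × F) :
    modelFlow (s + t) p = modelFlow s (modelFlow t p) := by
  refine Prod.ext ?_ ?_
  · simp only [modelFlow, neg_add, exp_add]; ring
  · simp only [modelFlow]; rw [smul_smul, ← exp_add]

/-- **The model flow solves `ẋ = -x`, `ẇ = w`.** [folklore] -/
theorem hasDerivAt_modelFlow (p : ℝ × F) (t : ℝ) :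
    HasDerivAt (fun s => modelFlow s p) (-(modelFlow t p).1, (modelFlow t p).2) t := by
  have h1 : HasDerivAt (fun s => exp (-s) * p.1) (-(modelFlow t p).1) t := by
    have h := ((hasDerivAt_neg t).exp).mul_const p.1
    simpa [modelFlow] using h
  have h2 : HasDerivAt (fun s => exp s • p.2) ((modelFlow t p).2) t := by
    have h := (hasDerivAt_exp t).smul_const p.2
    simpa [modelFlow] using h
  exact h1.prodMk h2

/-- **The invariant `x w`** is constant along the model flow. [folklore] -/
theorem modelFlow_fst_smul_snd (t : ℝ) (p : ℝ × F) :
    (modelFlow t p).1 • (modelFlow t p).2 = p.1 • p.2 := by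
  simp only [modelFlow, smul_smul]
  rw [show exp (-t) * p.1 * exp t = p.1 by rw [mul_comm, ← mul_assoc, exp_neg]; field_simp]

/-- The quadratic form `q(x, w) = -x² + ‖w‖²` along the flow:
`q(φ_t p) = -e^{-2t} x² + e^{2t} ‖w‖²`. [folklore] -/
theorem quad_modelFlow (t : ℝ) (p : ℝ × F) :
    -(modelFlow t p).1 ^ 2 + ‖(modelFlow t p).2‖ ^ 2 =
      -(exp (-t)) ^ 2 * p.1 ^ 2 + (exp t) ^ 2 * ‖p.2‖ ^ 2 := by
  simp only [modelFlow, norm_smul, Real.norm_eq_abs, abs_of_pos (exp_pos t)]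
  ring

/-- **The transit map** from the region `x > 0` to the sheet `x' > 0` of the lower level
`{x² - ‖w‖² = ε}` along the model flow: `T (x, w) = (x'(x‖w‖), (x/x'(x‖w‖)) • w)`. [folklore] -/
def transit (ε : ℝ) (p : ℝ × F) : ℝ × F :=
  (exitX ε (p.1 * ‖p.2‖), (p.1 / exitX ε (p.1 * ‖p.2‖)) • p.2)

/-- `‖w'‖ = x ‖w‖ / x'` (`x ≥ 0`). [folklore] -/
theorem norm_transit_snd' (hε : 0 < ε) {p : ℝ × F} (hp : 0 ≤ p.1) :
    ‖(transit ε p).2‖ = p.1 * ‖p.2‖ / exitX ε (p.1 * ‖p.2‖) := by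
  have hx' := exitX_pos hε (p.1 * ‖p.2‖)
  show ‖(p.1 / exitX ε (p.1 * ‖p.2‖)) • p.2‖ = _
  rw [norm_smul, Real.norm_eq_abs, abs_of_nonneg (div_nonneg hp hx'.le)]
  ring

/-- **The transit lands on the lower level**: `x'² - ‖w'‖² = ε` (`x ≥ 0`). [folklore] -/
theorem transit_level (hε : 0 < ε) {p : ℝ × F} (hp : 0 ≤ p.1) :
    (transit ε p).1 ^ 2 - ‖(transit ε p).2‖ ^ 2 = ε := by
  rw [norm_transit_snd' hε hp]
  have h := exitX_sq_sub_radial_sq hε (p.1 * ‖p.2‖)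
  rw [radial] at h
  exact h

/-- **The transit point lies on the trajectory**: `T p = φ_t p` for `t = log (x / x')` (`x > 0`).
[folklore] -/
theorem transit_eq_modelFlow (hε : 0 < ε) {p : ℝ × F} (hp : 0 < p.1) :
    transit ε p = modelFlow (Real.log (p.1 / exitX ε (p.1 * ‖p.2‖))) p := by
  have hx' := exitX_pos hε (p.1 * ‖p.2‖)
  have hq : 0 < p.1 / exitX ε (p.1 * ‖p.2‖) := div_pos hp hx'
  rw [modelFlow, exp_neg, exp_log hq]
  refine Prod.ext ?_ rfl
  show exitX ε (p.1 * ‖p.2‖) = (p.1 / exitX ε (p.1 * ‖p.2‖))⁻¹ * p.1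
  field_simp

/-- The norm of the second component of the transit: `‖w'‖ = r(x‖w‖)` (`x ≥ 0`). [folklore] -/
theorem norm_transit_snd (hε : 0 < ε) {p : ℝ × F} (hp : 0 ≤ p.1) :
    ‖(transit ε p).2‖ = radial ε (p.1 * ‖p.2‖) := by
  rw [norm_transit_snd' hε hp, radial]

/-- **Polar form of the transit (the blow-down)**: for a unit vector `θ`, `s ≥ 0` and `x ≥ 0`,
`T (x, s θ) = (x'(x s), r(x s) θ)` — in the polar coordinates `(r, θ)` of the `w`-plane the
transit is the identity on the angle and the smooth strictly increasing reparametrisation `r`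
of the invariant `m = x s` on the radius; as `x ↓ 0` the circle `{x} × {‖w‖ = s}` collapses
onto the foot `(√ε, 0)` of the stable manifold, each point approaching it along its own ray.
[folklore] -/
theorem transit_smul_unit {x s : ℝ} (hs : 0 ≤ s) {θ : F} (hθ : ‖θ‖ = 1) :
    transit ε (x, s • θ) = (exitX ε (x * s), radial ε (x * s) • θ) := by
  have hn : ‖s • θ‖ = s := by rw [norm_smul, Real.norm_eq_abs, abs_of_nonneg hs, hθ, mul_one]
  refine Prod.ext ?_ ?_
  · show exitX ε (x * ‖s • θ‖) = exitX ε (x * s)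
    rw [hn]
  · show (x / exitX ε (x * ‖s • θ‖)) • s • θ = radial ε (x * s) • θ
    rw [hn, smul_smul, radial]
    congr 1
    ring

/-- The squared exit abscissa of the transit is a smooth function on all of `ℝ × F`: it only
depends on `(x‖w‖)² = x²‖w‖²`. [folklore] -/
theorem contDiff_exitSq_invariant (hε : 0 < ε) {n : ℕ∞} :
    ContDiff ℝ n (fun p : ℝ × F => exitSq ε (p.1 * ‖p.2‖)) := by
  have he : (fun p : ℝ × F => exitSq ε (p.1 * ‖p.2‖)) =
      fun p => (ε + √(ε ^ 2 + 4 * (p.1 ^ 2 * ‖p.2‖ ^ 2))) / 2 := by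
    funext p; simp only [exitSq, mul_pow]
  rw [he]
  refine (contDiff_const.add (ContDiff.sqrt ?_ fun p => by positivity)).div_const _
  exact contDiff_const.add (contDiff_const.mul
    ((contDiff_fst.pow 2).mul ((contDiff_norm_sq ℝ).comp contDiff_snd)))

/-- **The transit map is smooth** on all of `ℝ × F` (`ε > 0`): `x' = √X` with `X ≥ ε > 0`
smooth, and `w' = (x / x') w`. [folklore] -/
theorem contDiff_transit (hε : 0 < ε) {n : ℕ∞} : ContDiff ℝ n (transit ε : ℝ × F → ℝ × F) := by
  have hX : ContDiff ℝ n (fun p : ℝ × F => exitX ε (p.1 * ‖p.2‖)) :=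
    (contDiff_exitSq_invariant hε).sqrt fun p => (exitSq_pos hε _).ne'
  refine hX.prodMk ((contDiff_fst.div hX fun p => (exitX_pos hε _).ne').smul contDiff_snd)

/-- **Continuity of the blow-down at the belt circle**: as `x → 0` (with `w` bounded), the
transit point tends to the foot `(√ε, 0)`; precisely `T (0, w) = (√ε, 0)` and `T` is continuous.
[folklore] -/
theorem transit_zero_fst (hε : 0 < ε) (w : F) : transit ε ((0 : ℝ), w) = (√ε, 0) := by
  refine Prod.ext ?_ ?_
  · show exitX ε (0 * ‖w‖) = √ε
    rw [zero_mul, exitX, exitSq_zero hε.le]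
  · show ((0 : ℝ) / exitX ε (0 * ‖w‖)) • w = 0
    rw [zero_div, zero_smul]

end SaddleTransit

end Literature.Topology.FourManifolds

end
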